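import Summits.Parity.GeneralizedHardyLittlewood.Cruxes.TableChowla.Disproof

/-!
# Calibration (crux-ideate, ideator 2, round 1): the TEST-VECTOR FACES of `TableChowla`

Crux `Summit.Parity.GeneralizedHardyLittlewood.Theses.LiouvilleShiftedTables.TableChowla`
(stmt-Parity-14270): `T := Σ_{a,a' ∈ (A,2A]} (Σ_{b ≤ x/A} λ(ab+c)λ(a'b+c))² ≤ x²/(log x)^C` for
every `C`, uniformly for `x^δ ≤ A ≤ x^{1/3+δ}` (`0 < δ ≤ 1/12`, `c ≠ 0`).

This file records, KERNEL-CHECKED, what the crux CONTAINS (necessity side), sharpening the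
refuter's (i) `fixedResidueFace_of_tableChowla` and ideator 3's `Calibration.lean`:

* `tableChowla_iff_boundedTestVectorFace` — **EQUIVALENT FORM**: the crux is EXACTLY the
  bounded-coefficient Type-II statement `|Σ_{a∼A} Σ_{b≤x/A} u_a v_b λ(ab+c)| ≤ 2x/(log x)^C`
  (all `1`-bounded real `u, v`, every `C`, whole window). Both directions are elementary and
  SVD-free: `→` is `bilinear_sq_le`; `←` tests the form, row by row, at `u = S(a,·)/B`, `v = λ(a·+c)`
  (`Σ_{a'} S(a,a')² = B · form(u,v)`), so `T ≤ rows·B·2x/(log x)^{C+2} ≤ x²/(log x)^C`. This is the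
  cut-norm / "bilinear expressions" form (Polymath 8b §8) that sieve glue consumes, now
  kernel-checked against the route decl (the gen-1 sketch's `tableChowla_of_operatorNormForm` was a
  sorried stub).
* `bilinear_sq_le` (any `f`, any real test vectors `u, v`): the master inequality
  `(Σ_a Σ_b u_a v_b f(ab+c))² ≤ (Σ_a u_a²)(Σ_b v_b²) √T` — two Cauchy–Schwarz steps and the column
  duality `momentN_eq_colMoment`; no spectral theorem.
* `boundedTestVectorFace_of_tableChowla`: the crux implies, for ALL `1`-bounded coefficient
  sequences `u, v` (no Siegel–Walfisz, no structure), `|Σ_{a∼A} Σ_{b≤x/A} u_a v_b λ(ab+c)| ≤ 2x/(log x)^C`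
  for every `C` — i.e. the full arbitrary-coefficient Type-II bound ("bilinear expressions",
  Polymath 8b §8) with every log-power saving, on the whole window.
* `primeShiftFace_of_tableChowla` (`u = 𝟙`, `v = 𝟙_{primes}`): the crux implies the PARITY-TYPE
  statement `|Σ_{a ∼ A} Σ_{p ≤ x/A, p prime} λ(ap+c)| ≤ 2x/(log x)^C` — Liouville does not correlate
  with the shifted products `a·p + c` (`a` smooth of size `A ≥ x^δ`, `p` prime), directly, with no
  sieve glue, no Elliott–Halberstam and no Type-I₂ input.
* `hyperbolicTernary_of_tableChowla` (`u = v = λ`, using `λ(a)λ(b) = λ(ab)`): the crux implies the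
  `r_A`-weighted binary Chowla bound `|Σ_{a∼A} Σ_{b ≤ x/A} λ(ab) λ(ab+c)| ≤ 2x/(log x)^C` (the first
  lemma announced by this seat's gen-1 card `helson-kronecker-inverse`, now proved).
* `columnVarianceFace_of_tableChowla`: the crux implies the fixed-residue VARIANCE bound
  `Σ_{b ≤ x/A} (Σ_{a∼A} λ(ab+c))² ≤ 2A·x/(log x)^C` (`colSum'`; moduli `b` up to `x^{1−δ}`, segments of `x^δ`
  terms of the class `c mod b`), a `(log x)^{-C}` saving over the trivial `A²B`: for the window's
  moduli `x^{7/12} ≤ x/A ≤ x^{11/12}` this is the Friedlander–Goldston range `(x^{1/2}, x^{3/4})` and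
  beyond, where fixed-residue variance bounds for `λ` are not available even under GRH
  (Hooley's conditional range starts at `x^{3/4}`); unconditionally the frontier for a fixed
  residue beyond `x^{1/2}` is `x^{1/2+1/66}` for narrow Type-II sums (Fouvry–Radziwiłł 2018,
  arXiv:1812.00562, Thm 1.1) and `x^{1/2+1/78}` for `λ` itself at almost all PRIME moduli with
  `o(1)` precision (Green 2017, arXiv:1604.04481, Cor. 1.2).

* `primeBlockFace_of_cmTestVectorBound'` — **Lemma A of the Gen-2 addendum to card `helson-kronecker-inverse`**:
  the card's TWO-SIDED residual `CMTestVectorBound'` (bilinear form small for all completely multiplicative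
  `1`-bounded complex `f, g`) already contains the plain sign-discrepancy of every block `P × Q` of primes that are
  private to their row/column (e.g. `P ⊆ ℙ∩(A,2A]`, `Q ⊆ ℙ∩(x/2A, x/A]`): CM functions are free on primes, and the four
  CM pairs built from `cmSign P = 𝟙 − 2·𝟙_P`, `cmSign Q = 𝟙 − 2·𝟙_Q` give `4·𝟙_PᵀM𝟙_Q = fᵀMg − fᵀM𝟙 − 𝟙ᵀMg + 𝟙ᵀM𝟙`. So a
  two-sided CM residual re-imports Type II for `λ(pq+c)` over primes with arbitrary signs — the crux's core without
  factorable indices; the crux-plan's ONE-SIDED residual is the right cut. (`primeBlock_of_tableChowla`: the crux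
  implies the same face, constant `2`.)

All statements quantify exactly like the crux (`∀ c ≠ 0, ∀ δ ∈ (0,1/12], ∀ C > 0, ∃ x₀, ∀ x ≥ x₀,
∀ A ∈ [x^δ, x^{1/3+δ}]`). Everything is sorry-free (axioms `propext`, `Classical.choice`, `Quot.sound`).
-/

namespace Summit.Parity.GeneralizedHardyLittlewood.Cruxes.TableChowla.CalibrationIdeator2

open Finset Real
open Summit.Parity.GeneralizedHardyLittlewood.Theses
open Summit.Parity.GeneralizedHardyLittlewood.Cruxes.TableChowla.Disproof

noncomputable section

/-- Table entry `f(ab+c)` (same convention as `Disproof.rowCorr`). -/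
def ent (f : ℕ → ℝ) (c : ℤ) (a b : ℕ) : ℝ := f (Int.toNat ((a : ℤ) * b + c))

variable {f : ℕ → ℝ} {c : ℤ} {A₁ A₂ B : ℕ}

/-- Column duality restated with `ent`. -/
theorem momentN_eq_colMoment' :
    momentN f c A₁ A₂ B =
      ∑ b ∈ Icc 1 B, ∑ b' ∈ Icc 1 B, (∑ a ∈ Ioc A₁ A₂, ent f c a b * ent f c a b') ^ 2 :=
  momentN_eq_colMoment

/-- **Master inequality** (two Cauchy–Schwarz steps + column duality):
`(Σ_a Σ_b u_a v_b f(ab+c))² ≤ ‖u‖² ‖v‖² √T`. -/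
theorem bilinear_sq_le (u v : ℕ → ℝ) :
    (∑ a ∈ Ioc A₁ A₂, ∑ b ∈ Icc 1 B, u a * v b * ent f c a b) ^ 2 ≤
      (∑ a ∈ Ioc A₁ A₂, u a ^ 2) * (∑ b ∈ Icc 1 B, v b ^ 2) *
        Real.sqrt (momentN f c A₁ A₂ B) := by
  set R : Finset ℕ := Ioc A₁ A₂ with hR
  set Cc : Finset ℕ := Icc 1 B with hC
  -- Y a := Σ_b v_b f(ab+c)
  set Y : ℕ → ℝ := fun a => ∑ b ∈ Cc, v b * ent f c a b with hY
  have hrew : ∑ a ∈ R, ∑ b ∈ Cc, u a * v b * ent f c a b = ∑ a ∈ R, u a * Y a := by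
    refine sum_congr rfl fun a _ => ?_
    rw [hY, mul_sum]
    refine sum_congr rfl fun b _ => ?_
    ring
  -- step 1: CS over a
  have h1 : (∑ a ∈ R, u a * Y a) ^ 2 ≤ (∑ a ∈ R, u a ^ 2) * ∑ a ∈ R, Y a ^ 2 :=
    sum_mul_sq_le_sq_mul_sq R u Y
  -- step 2: Σ_a Y_a² = Σ_{b,b'} v_b v_b' K(b,b')
  set K : ℕ → ℕ → ℝ := fun b b' => ∑ a ∈ R, ent f c a b * ent f c a b' with hK
  have h2 : ∑ a ∈ R, Y a ^ 2 = ∑ b ∈ Cc, ∑ b' ∈ Cc, v b * v b' * K b b' := by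
    have : ∀ a, Y a ^ 2 = ∑ b ∈ Cc, ∑ b' ∈ Cc, v b * v b' * (ent f c a b * ent f c a b') := by
      intro a
      rw [hY, sq, sum_mul_sum]
      refine sum_congr rfl fun b _ => sum_congr rfl fun b' _ => ?_
      ring
    simp_rw [this]
    rw [sum_comm]
    refine sum_congr rfl fun b _ => ?_
    rw [sum_comm]
    refine sum_congr rfl fun b' _ => ?_
    rw [hK, mul_sum]
  -- step 3: CS over pairs (b,b')
  have h3 : (∑ b ∈ Cc, ∑ b' ∈ Cc, v b * v b' * K b b') ^ 2 ≤
      (∑ b ∈ Cc, v b ^ 2) ^ 2 * momentN f c A₁ A₂ B := by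
    have hcs := sum_mul_sq_le_sq_mul_sq (Cc ×ˢ Cc) (fun p => v p.1 * v p.2) (fun p => K p.1 p.2)
    have e1 : ∑ p ∈ Cc ×ˢ Cc, v p.1 * v p.2 * K p.1 p.2 = ∑ b ∈ Cc, ∑ b' ∈ Cc, v b * v b' * K b b' := by
      rw [sum_product]
    have e2 : ∑ p ∈ Cc ×ˢ Cc, (v p.1 * v p.2) ^ 2 = (∑ b ∈ Cc, v b ^ 2) ^ 2 := by
      rw [sum_product, sq, sum_mul_sum]
      refine sum_congr rfl fun b _ => sum_congr rfl fun b' _ => ?_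
      ring
    have e3 : ∑ p ∈ Cc ×ˢ Cc, K p.1 p.2 ^ 2 = momentN f c A₁ A₂ B := by
      rw [momentN_eq_colMoment', sum_product]
    rw [e1, e2, e3] at hcs
    exact hcs
  have hT0 : 0 ≤ momentN f c A₁ A₂ B := momentN_nonneg
  have h4 : ∑ b ∈ Cc, ∑ b' ∈ Cc, v b * v b' * K b b' ≤
      (∑ b ∈ Cc, v b ^ 2) * Real.sqrt (momentN f c A₁ A₂ B) := by
    have hsq : (∑ b ∈ Cc, ∑ b' ∈ Cc, v b * v b' * K b b') ^ 2 ≤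
        ((∑ b ∈ Cc, v b ^ 2) * Real.sqrt (momentN f c A₁ A₂ B)) ^ 2 := by
      rw [mul_pow, Real.sq_sqrt hT0]; exact h3
    have hnn : 0 ≤ (∑ b ∈ Cc, v b ^ 2) * Real.sqrt (momentN f c A₁ A₂ B) :=
      mul_nonneg (sum_nonneg fun _ _ => sq_nonneg _) (Real.sqrt_nonneg _)
    exact (abs_le_of_sq_le_sq' hsq hnn).2
  have hu0 : 0 ≤ ∑ a ∈ R, u a ^ 2 := sum_nonneg fun _ _ => sq_nonneg _
  calc (∑ a ∈ R, ∑ b ∈ Cc, u a * v b * ent f c a b) ^ 2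
      = (∑ a ∈ R, u a * Y a) ^ 2 := by rw [hrew]
    _ ≤ (∑ a ∈ R, u a ^ 2) * ∑ a ∈ R, Y a ^ 2 := h1
    _ = (∑ a ∈ R, u a ^ 2) * ∑ b ∈ Cc, ∑ b' ∈ Cc, v b * v b' * K b b' := by rw [h2]
    _ ≤ (∑ a ∈ R, u a ^ 2) * ((∑ b ∈ Cc, v b ^ 2) * Real.sqrt (momentN f c A₁ A₂ B)) :=
        mul_le_mul_of_nonneg_left h4 hu0
    _ = _ := by ring

/-- Norm bookkeeping for `1`-bounded test vectors: `Σ_{s} w² ≤ #s`. -/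
theorem sum_sq_le_card {s : Finset ℕ} {w : ℕ → ℝ} (hw : ∀ n, |w n| ≤ 1) :
    ∑ n ∈ s, w n ^ 2 ≤ s.card := by
  calc ∑ n ∈ s, w n ^ 2 ≤ ∑ _n ∈ s, (1 : ℝ) := by
        refine sum_le_sum fun n _ => ?_
        have h := hw n
        have h1 : w n ^ 2 ≤ 1 ^ 2 := sq_le_sq' (by linarith [(abs_le.mp h).1]) (abs_le.mp h).2
        simpa using h1
    _ = s.card := by simp

/-- Column sums `G(b) = Σ_{a ∈ (A₁,A₂]} f(ab+c)` (own copy; the farm's built `Disproof` may predate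
the refuter's `colSum`). -/
def colSum' (f : ℕ → ℝ) (c : ℤ) (A₁ A₂ b : ℕ) : ℝ := ∑ a ∈ Ioc A₁ A₂, ent f c a b

/-- Dispersion identity `Σ_b G(b)² = Σ_{a,a'} S(a,a')`. -/
theorem sum_colSum'_sq : ∑ b ∈ Icc 1 B, colSum' f c A₁ A₂ b ^ 2 =
    ∑ a ∈ Ioc A₁ A₂, ∑ a' ∈ Ioc A₁ A₂, rowCorr f c B a a' := by
  unfold colSum' rowCorr ent
  simp_rw [sq, sum_mul_sum]
  simp_rw [sum_comm (s := Ioc A₁ A₂) (t := Icc 1 B)]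

/-! ## The faces of the crux -/

/-- FACE 1 (all bounded test vectors): the arbitrary-coefficient Type-II bound on the window. -/
def BoundedTestVectorFace : Prop :=
  ∀ c : ℤ, c ≠ 0 → ∀ δ : ℝ, 0 < δ → δ ≤ 1 / 12 → ∀ C : ℝ, 0 < C → ∃ x₀ : ℝ, ∀ x : ℝ, x₀ ≤ x →
    ∀ A : ℝ, x ^ δ ≤ A → A ≤ x ^ (1 / 3 + δ) →
    ∀ u v : ℕ → ℝ, (∀ n, |u n| ≤ 1) → (∀ n, |v n| ≤ 1) →
      |∑ a ∈ Ioc ⌊A⌋₊ ⌊2 * A⌋₊, ∑ b ∈ Icc 1 ⌊x / A⌋₊, u a * v b * ent lam c a b| ≤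
        2 * x / Real.log x ^ C

/-- FACE 2 (`u = 𝟙`, `v = 𝟙_ℙ`): Liouville along the shifted products `a·p + c`, `p` prime. -/
def PrimeShiftFace : Prop :=
  ∀ c : ℤ, c ≠ 0 → ∀ δ : ℝ, 0 < δ → δ ≤ 1 / 12 → ∀ C : ℝ, 0 < C → ∃ x₀ : ℝ, ∀ x : ℝ, x₀ ≤ x →
    ∀ A : ℝ, x ^ δ ≤ A → A ≤ x ^ (1 / 3 + δ) →
      |∑ a ∈ Ioc ⌊A⌋₊ ⌊2 * A⌋₊, ∑ p ∈ (Icc 1 ⌊x / A⌋₊).filter Nat.Prime,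
          lam (Int.toNat ((a : ℤ) * p + c))| ≤ 2 * x / Real.log x ^ C

/-- FACE 3 (`u = v = λ`): the `r_A`-weighted binary Chowla sum `Σ_{a∼A} Σ_{b≤x/A} λ(ab)λ(ab+c)`. -/
def HyperbolicTernary : Prop :=
  ∀ c : ℤ, c ≠ 0 → ∀ δ : ℝ, 0 < δ → δ ≤ 1 / 12 → ∀ C : ℝ, 0 < C → ∃ x₀ : ℝ, ∀ x : ℝ, x₀ ≤ x →
    ∀ A : ℝ, x ^ δ ≤ A → A ≤ x ^ (1 / 3 + δ) →
      |∑ a ∈ Ioc ⌊A⌋₊ ⌊2 * A⌋₊, ∑ b ∈ Icc 1 ⌊x / A⌋₊,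
          lam (a * b) * lam (Int.toNat ((a : ℤ) * b + c))| ≤ 2 * x / Real.log x ^ C

/-- FACE 4 (fixed-residue variance): `Σ_{b≤x/A} (Σ_{a∼A} λ(ab+c))² ≤ 2A·x/(log x)^C`. -/
def ColumnVarianceFace : Prop :=
  ∀ c : ℤ, c ≠ 0 → ∀ δ : ℝ, 0 < δ → δ ≤ 1 / 12 → ∀ C : ℝ, 0 < C → ∃ x₀ : ℝ, ∀ x : ℝ, x₀ ≤ x →
    ∀ A : ℝ, x ^ δ ≤ A → A ≤ x ^ (1 / 3 + δ) →
      (∑ b ∈ Icc 1 ⌊x / A⌋₊, colSum' lam c ⌊A⌋₊ ⌊2 * A⌋₊ b ^ 2) ≤ 2 * A * x / Real.log x ^ C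

/-! ## Proofs -/

/-- Window bookkeeping: for `x ≥ 0` and `1 ≤ A`: `rows · B ≤ 2x`, where `rows = ⌊2A⌋ − ⌊A⌋ ≤ A + 1`
and `B = ⌊x/A⌋ ≤ x/A`. -/
theorem rowsB_le {x A : ℝ} (hx : 0 ≤ x) (hA1 : 1 ≤ A) :
    ((⌊2 * A⌋₊ - ⌊A⌋₊ : ℕ) : ℝ) * (⌊x / A⌋₊ : ℝ) ≤ 2 * x := by
  have hApos : 0 < A := by linarith
  have hrows : ((⌊2 * A⌋₊ - ⌊A⌋₊ : ℕ) : ℝ) ≤ A + 1 := by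
    rw [Nat.cast_sub (Nat.floor_le_floor (by linarith : A ≤ 2 * A))]
    have h1 : (⌊2 * A⌋₊ : ℝ) ≤ 2 * A := Nat.floor_le (by linarith)
    have h2 : A - 1 < (⌊A⌋₊ : ℝ) := by have := Nat.lt_floor_add_one A; linarith
    linarith
  have hB : (⌊x / A⌋₊ : ℝ) ≤ x / A := Nat.floor_le (by positivity)
  have hxA : x / A ≤ x := div_le_self hx hA1
  calc ((⌊2 * A⌋₊ - ⌊A⌋₊ : ℕ) : ℝ) * (⌊x / A⌋₊ : ℝ) ≤ (A + 1) * (x / A) :=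
        mul_le_mul hrows hB (Nat.cast_nonneg _) (by linarith)
    _ = x + x / A := by field_simp
    _ ≤ 2 * x := by linarith

/-- `√T ≤ x / L²` from the crux at level `4C` (with `L = (log x)^C`). -/
theorem sqrt_moment_le {x A L C : ℝ} (hlogpos : 0 < Real.log x) (hL : L = Real.log x ^ C)
    (hx : 0 ≤ x) (key : moment lam c x A ≤ x ^ 2 / Real.log x ^ (4 * C)) :
    Real.sqrt (moment lam c x A) ≤ x / L ^ 2 := by
  have hLpos : 0 < L := by rw [hL]; exact Real.rpow_pos_of_pos hlogpos C
  have h4C : (4 : ℝ) * C = C * ((4 : ℕ) : ℝ) := by push_cast; ring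
  have hpow : Real.log x ^ (4 * C) = L ^ 4 := by
    rw [hL, ← Real.rpow_natCast (Real.log x ^ C) 4, ← Real.rpow_mul hlogpos.le, ← h4C]
  rw [hpow] at key
  have hsq : (x / L ^ 2) ^ 2 = x ^ 2 / L ^ 4 := by ring
  calc Real.sqrt (moment lam c x A) ≤ Real.sqrt ((x / L ^ 2) ^ 2) := by
        apply Real.sqrt_le_sqrt; rw [hsq]; exact key
    _ = x / L ^ 2 := Real.sqrt_sq (by positivity)

/-- **FACE 1**: `TableChowla → BoundedTestVectorFace`. -/
theorem boundedTestVectorFace_of_tableChowla (h : LiouvilleShiftedTables.TableChowla) :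
    BoundedTestVectorFace := by
  intro c hc δ hδ hδ' C hC
  obtain ⟨x₀, hx₀⟩ := (tableChowla_iff.mp h) c hc δ hδ hδ' (4 * C) (by positivity)
  refine ⟨max x₀ (Real.exp 1), fun x hx A hA hA' u v hu hv => ?_⟩
  have hx₀x : x₀ ≤ x := le_trans (le_max_left _ _) hx
  have hxe : Real.exp 1 ≤ x := le_trans (le_max_right _ _) hx
  have hxpos : 0 < x := (Real.exp_pos 1).trans_le hxe
  have hx1 : 1 ≤ x := by have := Real.add_one_le_exp (1 : ℝ); linarith
  have hlog1 : 1 ≤ Real.log x := (Real.le_log_iff_exp_le hxpos).mpr hxe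
  have hlogpos : 0 < Real.log x := by linarith
  set L : ℝ := Real.log x ^ C with hL
  have hLpos : 0 < L := Real.rpow_pos_of_pos hlogpos C
  have hsqrt := sqrt_moment_le (c := c) hlogpos hL hxpos.le (hx₀ x hx₀x A hA hA')
  have hA1 : 1 ≤ A := le_trans (Real.one_le_rpow hx1 hδ.le) hA
  have hRB := rowsB_le hxpos.le hA1
  -- the master inequality
  have hm := bilinear_sq_le (f := lam) (c := c) (A₁ := ⌊A⌋₊) (A₂ := ⌊2 * A⌋₊) (B := ⌊x / A⌋₊) u v
  have hmom : momentN lam c ⌊A⌋₊ ⌊2 * A⌋₊ ⌊x / A⌋₊ = moment lam c x A := rfl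
  rw [hmom] at hm
  have hu2 := sum_sq_le_card (s := Ioc ⌊A⌋₊ ⌊2 * A⌋₊) hu
  have hv2 := sum_sq_le_card (s := Icc 1 ⌊x / A⌋₊) hv
  rw [Nat.card_Ioc] at hu2
  rw [Nat.card_Icc, Nat.add_sub_cancel] at hv2
  have hbound : (∑ a ∈ Ioc ⌊A⌋₊ ⌊2 * A⌋₊, ∑ b ∈ Icc 1 ⌊x / A⌋₊, u a * v b * ent lam c a b) ^ 2 ≤
      (2 * x / L) ^ 2 := by
    calc _ ≤ (∑ a ∈ Ioc ⌊A⌋₊ ⌊2 * A⌋₊, u a ^ 2) * (∑ b ∈ Icc 1 ⌊x / A⌋₊, v b ^ 2) *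
          Real.sqrt (moment lam c x A) := hm
      _ ≤ ((⌊2 * A⌋₊ - ⌊A⌋₊ : ℕ) : ℝ) * (⌊x / A⌋₊ : ℝ) * (x / L ^ 2) := by
          apply mul_le_mul _ hsqrt (Real.sqrt_nonneg _) (by positivity)
          exact mul_le_mul hu2 hv2 (sum_nonneg fun _ _ => sq_nonneg _) (Nat.cast_nonneg _)
      _ ≤ 2 * x * (x / L ^ 2) := mul_le_mul_of_nonneg_right hRB (by positivity)
      _ ≤ (2 * x / L) ^ 2 := by
          rw [div_pow, show 2 * x * (x / L ^ 2) = (2 * x) ^ 2 / L ^ 2 * (1 / 2) by field_simp; try ring]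
          apply mul_le_of_le_one_right (by positivity)
          norm_num
  have habs := abs_le_of_sq_le_sq' hbound (by positivity)
  exact abs_le.mpr habs

/-- **FACE 2**: `TableChowla → PrimeShiftFace` (test vectors `u = 𝟙`, `v = 𝟙_ℙ`). -/
theorem primeShiftFace_of_tableChowla (h : LiouvilleShiftedTables.TableChowla) :
    PrimeShiftFace := by
  intro c hc δ hδ hδ' C hC
  obtain ⟨x₀, hx₀⟩ := boundedTestVectorFace_of_tableChowla h c hc δ hδ hδ' C hC
  refine ⟨x₀, fun x hx A hA hA' => ?_⟩
  have key := hx₀ x hx A hA hA' (fun _ => 1) (fun n => if n.Prime then 1 else 0)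
    (fun _ => by simp) (fun n => by by_cases hn : n.Prime <;> simp [hn])
  have hrew : ∑ a ∈ Ioc ⌊A⌋₊ ⌊2 * A⌋₊, ∑ p ∈ (Icc 1 ⌊x / A⌋₊).filter Nat.Prime,
      lam (Int.toNat ((a : ℤ) * p + c)) =
      ∑ a ∈ Ioc ⌊A⌋₊ ⌊2 * A⌋₊, ∑ b ∈ Icc 1 ⌊x / A⌋₊,
        (1 : ℝ) * (if b.Prime then 1 else 0) * ent lam c a b := by
    refine sum_congr rfl fun a _ => ?_
    rw [sum_filter]
    refine sum_congr rfl fun b _ => ?_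
    by_cases hb : b.Prime <;> simp [hb, ent]
  rw [hrew]
  exact key

/-- **FACE 3**: `TableChowla → HyperbolicTernary` (test vectors `u = v = λ`, `λ(a)λ(b) = λ(ab)`). -/
theorem hyperbolicTernary_of_tableChowla (h : LiouvilleShiftedTables.TableChowla) :
    HyperbolicTernary := by
  intro c hc δ hδ hδ' C hC
  obtain ⟨x₀, hx₀⟩ := boundedTestVectorFace_of_tableChowla h c hc δ hδ hδ' C hC
  refine ⟨x₀, fun x hx A hA hA' => ?_⟩
  have key := hx₀ x hx A hA hA' lam lam abs_lam_le_one abs_lam_le_one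
  have hrew : ∑ a ∈ Ioc ⌊A⌋₊ ⌊2 * A⌋₊, ∑ b ∈ Icc 1 ⌊x / A⌋₊,
      lam (a * b) * lam (Int.toNat ((a : ℤ) * b + c)) =
      ∑ a ∈ Ioc ⌊A⌋₊ ⌊2 * A⌋₊, ∑ b ∈ Icc 1 ⌊x / A⌋₊, lam a * lam b * ent lam c a b := by
    refine sum_congr rfl fun a _ => sum_congr rfl fun b _ => ?_
    rw [lam_mul, ent]
  rw [hrew]
  exact key

/-- **FACE 4**: `TableChowla → ColumnVarianceFace` (crux at level `2C`; one Cauchy–Schwarz over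
the `rows²` pairs: `Σ_b G(b)² = Σ_{a,a'} S(a,a') ≤ rows·√T ≤ 2A · x/(log x)^C`). -/
theorem columnVarianceFace_of_tableChowla (h : LiouvilleShiftedTables.TableChowla) :
    ColumnVarianceFace := by
  intro c hc δ hδ hδ' C hC
  obtain ⟨x₀, hx₀⟩ := (tableChowla_iff.mp h) c hc δ hδ hδ' (2 * C) (by positivity)
  refine ⟨max x₀ (Real.exp 1), fun x hx A hA hA' => ?_⟩
  have hx₀x : x₀ ≤ x := le_trans (le_max_left _ _) hx
  have hxe : Real.exp 1 ≤ x := le_trans (le_max_right _ _) hx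
  have hxpos : 0 < x := (Real.exp_pos 1).trans_le hxe
  have hx1 : 1 ≤ x := by have := Real.add_one_le_exp (1 : ℝ); linarith
  have hlog1 : 1 ≤ Real.log x := (Real.le_log_iff_exp_le hxpos).mpr hxe
  have hlogpos : 0 < Real.log x := by linarith
  set L : ℝ := Real.log x ^ C with hL
  have hLpos : 0 < L := Real.rpow_pos_of_pos hlogpos C
  have key := hx₀ x hx₀x A hA hA'
  -- √T ≤ x / L
  have h2C : (2 : ℝ) * C = C * ((2 : ℕ) : ℝ) := by push_cast; ring
  have hpow : Real.log x ^ (2 * C) = L ^ 2 := by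
    rw [hL, ← Real.rpow_natCast (Real.log x ^ C) 2, ← Real.rpow_mul hlogpos.le, ← h2C]
  rw [hpow] at key
  have hsqrt : Real.sqrt (moment lam c x A) ≤ x / L := by
    calc Real.sqrt (moment lam c x A) ≤ Real.sqrt ((x / L) ^ 2) := by
          apply Real.sqrt_le_sqrt; rw [div_pow]; exact key
      _ = x / L := Real.sqrt_sq (by positivity)
  -- Σ_b G² = Σ_{a,a'} S ≤ rows √T
  set R : Finset ℕ := Ioc ⌊A⌋₊ ⌊2 * A⌋₊ with hR
  set Bn : ℕ := ⌊x / A⌋₊ with hBn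
  have hT0 : 0 ≤ momentN lam c ⌊A⌋₊ ⌊2 * A⌋₊ Bn := momentN_nonneg
  have h3 : (∑ a ∈ R, ∑ a' ∈ R, rowCorr lam c Bn a a') ^ 2 ≤
      ((R.card : ℝ)) ^ 2 * momentN lam c ⌊A⌋₊ ⌊2 * A⌋₊ Bn := by
    have hcs := sum_mul_sq_le_sq_mul_sq (R ×ˢ R) (fun _ => (1 : ℝ)) (fun p => rowCorr lam c Bn p.1 p.2)
    have e1 : ∑ p ∈ R ×ˢ R, (1 : ℝ) * rowCorr lam c Bn p.1 p.2 = ∑ a ∈ R, ∑ a' ∈ R, rowCorr lam c Bn a a' := by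
      rw [sum_product]; simp
    have e2 : ∑ p ∈ R ×ˢ R, rowCorr lam c Bn p.1 p.2 ^ 2 = momentN lam c ⌊A⌋₊ ⌊2 * A⌋₊ Bn := by
      unfold momentN; rw [sum_product]
    have e3 : ∑ _p ∈ R ×ˢ R, (1 : ℝ) ^ 2 = (R.card : ℝ) ^ 2 := by simp [card_product, sq]
    rw [e1, e2, e3] at hcs
    exact hcs
  have h4 : ∑ a ∈ R, ∑ a' ∈ R, rowCorr lam c Bn a a' ≤ (R.card : ℝ) * Real.sqrt (momentN lam c ⌊A⌋₊ ⌊2 * A⌋₊ Bn) := by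
    have hsq : (∑ a ∈ R, ∑ a' ∈ R, rowCorr lam c Bn a a') ^ 2 ≤
        ((R.card : ℝ) * Real.sqrt (momentN lam c ⌊A⌋₊ ⌊2 * A⌋₊ Bn)) ^ 2 := by
      rw [mul_pow, Real.sq_sqrt hT0]; exact h3
    exact (abs_le_of_sq_le_sq' hsq (by positivity)).2
  have hmom : momentN lam c ⌊A⌋₊ ⌊2 * A⌋₊ Bn = moment lam c x A := rfl
  rw [hmom] at h4
  -- rows ≤ 2A
  have hApos : 0 ≤ A := le_trans (Real.rpow_nonneg hxpos.le δ) hA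
  have hrows : (R.card : ℝ) ≤ 2 * A := by
    rw [hR, Nat.card_Ioc]
    have h1 : ((⌊2 * A⌋₊ - ⌊A⌋₊ : ℕ) : ℝ) ≤ (⌊2 * A⌋₊ : ℝ) := by
      exact_mod_cast Nat.sub_le _ _
    have h2 : (⌊2 * A⌋₊ : ℝ) ≤ 2 * A := Nat.floor_le (by positivity)
    linarith
  calc ∑ b ∈ Icc 1 Bn, colSum' lam c ⌊A⌋₊ ⌊2 * A⌋₊ b ^ 2
      = ∑ a ∈ R, ∑ a' ∈ R, rowCorr lam c Bn a a' := sum_colSum'_sq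
    _ ≤ (R.card : ℝ) * Real.sqrt (moment lam c x A) := h4
    _ ≤ (2 * A) * (x / L) := mul_le_mul hrows hsqrt (Real.sqrt_nonneg _) (by linarith)
    _ = 2 * A * x / L := by ring


/-! ## The converse: the crux IS the bounded-coefficient Type-II statement (no spectral theorem)

`BoundedTestVectorFace → TableChowla`: for each row `a`, `Σ_{a'} S(a,a')² = B · Σ_{a'} Σ_b (S(a,a')/B)·λ(ab+c)·λ(a'b+c)`
is `B` times the bilinear form at the `1`-bounded test vectors `u_{a'} = S(a,a')/B`, `v_b = λ(ab+c)`;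
summing over the `rows` rows, `T ≤ rows·B·(2x/(log x)^{C+2}) ≤ 4x²/(log x)^{C+2} ≤ x²/(log x)^C` once
`log x ≥ 2`. Hence `tableChowla_iff_boundedTestVectorFace`. -/

/-- `|S(a,a')| ≤ B` for `1`-bounded `f` (local copy). -/
theorem abs_rowCorr_le' (hf : ∀ n, |f n| ≤ 1) (a a' : ℕ) : |rowCorr f c B a a'| ≤ B := by
  unfold rowCorr
  calc |∑ b ∈ Icc 1 B, f (Int.toNat ((a : ℤ) * b + c)) * f (Int.toNat ((a' : ℤ) * b + c))|
      ≤ ∑ b ∈ Icc 1 B, |f (Int.toNat ((a : ℤ) * b + c)) * f (Int.toNat ((a' : ℤ) * b + c))| :=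
        abs_sum_le_sum_abs _ _
    _ ≤ ∑ _b ∈ Icc 1 B, (1 : ℝ) := by
        refine sum_le_sum fun b _ => ?_
        rw [abs_mul]
        calc |f (Int.toNat ((a : ℤ) * b + c))| * |f (Int.toNat ((a' : ℤ) * b + c))| ≤ 1 * 1 :=
              mul_le_mul (hf _) (hf _) (abs_nonneg _) zero_le_one
          _ = 1 := by ring
    _ = B := by simp

/-- Per-row identity: `Σ_{a'} S(a,a')² = Σ_{a'} Σ_b S(a,a') · f(ab+c) · f(a'b+c)`. -/
theorem sum_rowCorr_sq_eq (a : ℕ) :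
    ∑ a' ∈ Ioc A₁ A₂, rowCorr f c B a a' ^ 2 =
      ∑ a' ∈ Ioc A₁ A₂, ∑ b ∈ Icc 1 B, rowCorr f c B a a' * ent f c a b * ent f c a' b := by
  refine sum_congr rfl fun a' _ => ?_
  have hS : rowCorr f c B a a' = ∑ b ∈ Icc 1 B, ent f c a b * ent f c a' b := rfl
  calc rowCorr f c B a a' ^ 2 = rowCorr f c B a a' * ∑ b ∈ Icc 1 B, ent f c a b * ent f c a' b := by
        rw [sq, ← hS]
    _ = ∑ b ∈ Icc 1 B, rowCorr f c B a a' * (ent f c a b * ent f c a' b) := by rw [mul_sum]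
    _ = _ := by refine sum_congr rfl fun b _ => ?_; ring

/-- **Converse**: `BoundedTestVectorFace → TableChowla`. -/
theorem tableChowla_of_boundedTestVectorFace (h : BoundedTestVectorFace) :
    LiouvilleShiftedTables.TableChowla := by
  rw [tableChowla_iff]
  intro c hc δ hδ hδ' C hC
  obtain ⟨x₀, hx₀⟩ := h c hc δ hδ hδ' (C + 2) (by positivity)
  refine ⟨max x₀ (Real.exp 2), fun x hx A hA hA' => ?_⟩
  have hx₀x : x₀ ≤ x := le_trans (le_max_left _ _) hx
  have hxe : Real.exp 2 ≤ x := le_trans (le_max_right _ _) hx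
  have hxpos : 0 < x := (Real.exp_pos 2).trans_le hxe
  have hx1 : 1 ≤ x := by have := Real.add_one_le_exp (2 : ℝ); linarith
  have hlog2 : 2 ≤ Real.log x := (Real.le_log_iff_exp_le hxpos).mpr hxe
  have hlogpos : 0 < Real.log x := by linarith
  set L : ℝ := Real.log x ^ C with hL
  have hLpos : 0 < L := Real.rpow_pos_of_pos hlogpos C
  set L' : ℝ := Real.log x ^ (C + 2) with hL'
  have hL'eq : L' = L * Real.log x ^ 2 := by
    rw [hL', hL, Real.rpow_add hlogpos, Real.rpow_two]
  have hL'pos : 0 < L' := by rw [hL'eq]; positivity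
  have hA1 : 1 ≤ A := le_trans (Real.one_le_rpow hx1 hδ.le) hA
  have hRB := rowsB_le hxpos.le hA1
  set R : Finset ℕ := Ioc ⌊A⌋₊ ⌊2 * A⌋₊ with hR
  set Bn : ℕ := ⌊x / A⌋₊ with hBn
  -- per-row bound
  have hrow : ∀ a ∈ R, ∑ a' ∈ R, rowCorr lam c Bn a a' ^ 2 ≤ (Bn : ℝ) * (2 * x / L') := by
    intro a _
    by_cases hB0 : Bn = 0
    · have hz : ∑ a' ∈ R, rowCorr lam c Bn a a' ^ 2 = 0 := by
        refine sum_eq_zero fun a' _ => ?_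
        simp [rowCorr, hB0]
      rw [hz]
      exact mul_nonneg (Nat.cast_nonneg _) (div_nonneg (by linarith) hL'pos.le)
    have hBpos : (0 : ℝ) < Bn := by exact_mod_cast Nat.pos_of_ne_zero hB0
    have hu : ∀ n, |rowCorr lam c Bn a n / Bn| ≤ 1 := fun n => by
      rw [abs_div, abs_of_pos hBpos, div_le_one hBpos]
      exact abs_rowCorr_le' abs_lam_le_one a n
    have hv : ∀ n, |ent lam c a n| ≤ 1 := fun n => abs_lam_le_one _
    have key := hx₀ x hx₀x A hA hA' (fun a' => rowCorr lam c Bn a a' / Bn) (fun b => ent lam c a b) hu hv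
    have hid : ∑ a' ∈ R, ∑ b ∈ Icc 1 Bn, rowCorr lam c Bn a a' * ent lam c a b * ent lam c a' b =
        (Bn : ℝ) * ∑ a' ∈ R, ∑ b ∈ Icc 1 Bn,
          rowCorr lam c Bn a a' / Bn * ent lam c a b * ent lam c a' b := by
      rw [mul_sum]
      refine sum_congr rfl fun a' _ => ?_
      rw [mul_sum]
      refine sum_congr rfl fun b _ => ?_
      field_simp
    rw [sum_rowCorr_sq_eq, hid]
    exact mul_le_mul_of_nonneg_left (le_trans (le_abs_self _) key) hBpos.le
  -- sum over the rows
  have hmom : moment lam c x A = ∑ a ∈ R, ∑ a' ∈ R, rowCorr lam c Bn a a' ^ 2 := rfl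
  have hrows : (R.card : ℝ) * (Bn : ℝ) ≤ 2 * x := by rw [hR, Nat.card_Ioc]; exact hRB
  calc moment lam c x A = ∑ a ∈ R, ∑ a' ∈ R, rowCorr lam c Bn a a' ^ 2 := hmom
    _ ≤ ∑ _a ∈ R, (Bn : ℝ) * (2 * x / L') := sum_le_sum hrow
    _ = (R.card : ℝ) * (Bn : ℝ) * (2 * x / L') := by rw [sum_const, nsmul_eq_mul]; ring
    _ ≤ 2 * x * (2 * x / L') := mul_le_mul_of_nonneg_right hrows (by positivity)
    _ = x ^ 2 / L * (4 / Real.log x ^ 2) := by rw [hL'eq]; field_simp; ring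
    _ ≤ x ^ 2 / L * 1 := by
        apply mul_le_mul_of_nonneg_left _ (by positivity)
        rw [div_le_one (by positivity)]
        nlinarith
    _ = x ^ 2 / L := by ring

/-- **EQUIVALENT FORM (cut-norm / bounded coefficients)**: `TableChowla ↔ BoundedTestVectorFace`. -/
theorem tableChowla_iff_boundedTestVectorFace :
    LiouvilleShiftedTables.TableChowla ↔ BoundedTestVectorFace :=
  ⟨boundedTestVectorFace_of_tableChowla, tableChowla_of_boundedTestVectorFace⟩


/-! ## Lemma A (gen-2 addendum to card `helson-kronecker-inverse`): the TWO-SIDED CM residual contains the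
prime ⊗ large-prime block

`CMTestVectorBound'` is the shape of the card's two-sided residual (`SketchIdeator2.CMTestVectorBound`, with this
file's `ent`): the bilinear form is small for ALL completely multiplicative `1`-bounded complex test vectors `f, g`.
Because CM functions are FREE on primes, the four CM pairs built from `f = 𝟙 − 2·𝟙_P`, `g = 𝟙 − 2·𝟙_Q` (realised by
`cmSign P`, `cmSign Q`: `f(p) = −1` on `P`, `+1` on every other prime) reproduce the plain sign-discrepancy of the block
`P × Q` whenever the primes of `P` (resp. `Q`) divide no other row (resp. column) — e.g. `P ⊆ ℙ ∩ (A,2A]`,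
`Q ⊆ ℙ ∩ (x/(2A), x/A]`. So the two-sided residual contains Type II for `λ(pq+c)` over primes with ARBITRARY signs:
the crux's core with the factorable indices removed. (This is why the crux-plan's ONE-SIDED residual is the right cut.) -/

/-- The completely multiplicative `±1` function with `f(p) = −1` exactly for `p ∈ P` (and `f 0 = 0`). -/
def cmSign (P : Finset ℕ) (n : ℕ) : ℂ :=
  if n = 0 then 0 else (-1) ^ (∑ p ∈ P, n.factorization p)

theorem cmSign_mul (P : Finset ℕ) (m n : ℕ) : cmSign P (m * n) = cmSign P m * cmSign P n := by
  by_cases hm : m = 0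
  · simp [cmSign, hm]
  by_cases hn : n = 0
  · simp [cmSign, hn]
  simp only [cmSign, hm, hn, mul_eq_zero, or_self, if_false]
  rw [Nat.factorization_mul hm hn]
  simp [Finset.sum_add_distrib, pow_add]

theorem norm_cmSign_le (P : Finset ℕ) (n : ℕ) : ‖cmSign P n‖ ≤ 1 := by
  unfold cmSign
  split_ifs <;> simp

/-- On an index whose only possible divisor from `P` is itself, `cmSign P` is `−1` on `P` and `+1` off `P`. -/
theorem cmSign_eq_of_private {P : Finset ℕ} {a : ℕ} (ha : a ≠ 0)
    (hP : ∀ p ∈ P, p.Prime ∧ (p ∣ a → a = p)) :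
    cmSign P a = if a ∈ P then -1 else 1 := by
  unfold cmSign
  rw [if_neg ha]
  by_cases haP : a ∈ P
  · have hsum : ∑ p ∈ P, a.factorization p = 1 := by
      rw [Finset.sum_eq_single_of_mem a haP]
      · exact (hP a haP).1.factorization_self
      · intro p hp hpa
        apply Nat.factorization_eq_zero_of_not_dvd
        intro hdiv
        exact hpa ((hP p hp).2 hdiv).symm
    rw [hsum, if_pos haP]; norm_num
  · have hsum : ∑ p ∈ P, a.factorization p = 0 := by
      refine Finset.sum_eq_zero fun p hp => ?_
      apply Nat.factorization_eq_zero_of_not_dvd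
      intro hdiv
      apply haP
      rw [(hP p hp).2 hdiv]; exact hp
    rw [hsum, if_neg haP]; norm_num

/-- The card's TWO-SIDED residual (shape of `SketchIdeator2.CMTestVectorBound`). -/
def CMTestVectorBound' : Prop :=
  ∀ c : ℤ, c ≠ 0 → ∀ δ : ℝ, 0 < δ → δ ≤ 1 / 12 → ∀ C : ℝ, 0 < C → ∃ x₀ : ℝ, ∀ x : ℝ, x₀ ≤ x →
    ∀ A : ℝ, x ^ δ ≤ A → A ≤ x ^ (1 / 3 + δ) →
    ∀ f g : ℕ → ℂ, (∀ m n, f (m * n) = f m * f n) → (∀ n, ‖f n‖ ≤ 1) →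
      (∀ m n, g (m * n) = g m * g n) → (∀ n, ‖g n‖ ≤ 1) →
      ‖∑ a ∈ Ioc ⌊A⌋₊ ⌊2 * A⌋₊, ∑ b ∈ Icc 1 ⌊x / A⌋₊, f a * g b * (ent lam c a b : ℂ)‖ ≤
        x / Real.log x ^ C

/-- FACE 5 (prime ⊗ large-prime block, arbitrary subsets): for all sets `P`, `Q` of primes that are PRIVATE to their
row/column (`p ∣ a ⇒ a = p` on the rows, `q ∣ b ⇒ b = q` on the columns), the plain discrepancy
`|Σ_{a ∈ rows ∩ P} Σ_{b ∈ cols ∩ Q} λ(ab+c)| ≤ x/(log x)^C`. -/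
def PrimeBlockFace : Prop :=
  ∀ c : ℤ, c ≠ 0 → ∀ δ : ℝ, 0 < δ → δ ≤ 1 / 12 → ∀ C : ℝ, 0 < C → ∃ x₀ : ℝ, ∀ x : ℝ, x₀ ≤ x →
    ∀ A : ℝ, x ^ δ ≤ A → A ≤ x ^ (1 / 3 + δ) →
    ∀ P Q : Finset ℕ,
      (∀ p ∈ P, p.Prime ∧ ∀ a ∈ Ioc ⌊A⌋₊ ⌊2 * A⌋₊, p ∣ a → a = p) →
      (∀ q ∈ Q, q.Prime ∧ ∀ b ∈ Icc 1 ⌊x / A⌋₊, q ∣ b → b = q) →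
      |∑ a ∈ (Ioc ⌊A⌋₊ ⌊2 * A⌋₊).filter (· ∈ P), ∑ b ∈ (Icc 1 ⌊x / A⌋₊).filter (· ∈ Q), ent lam c a b| ≤
        x / Real.log x ^ C

/-- **Lemma A**: `CMTestVectorBound' → PrimeBlockFace`. -/
theorem primeBlockFace_of_cmTestVectorBound' (h : CMTestVectorBound') : PrimeBlockFace := by
  intro c hc δ hδ hδ' C hC
  obtain ⟨x₀, hx₀⟩ := h c hc δ hδ hδ' C hC
  refine ⟨x₀, fun x hx A hA hA' P Q hP hQ => ?_⟩
  set R : Finset ℕ := Ioc ⌊A⌋₊ ⌊2 * A⌋₊ with hR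
  set Cc : Finset ℕ := Icc 1 ⌊x / A⌋₊ with hCc
  -- the four CM test-vector pairs
  have hone_mul : ∀ m n : ℕ, (fun _ : ℕ => (1 : ℂ)) (m * n) = (fun _ : ℕ => (1 : ℂ)) m * (fun _ : ℕ => (1 : ℂ)) n :=
    fun _ _ => by simp
  have hone_norm : ∀ n : ℕ, ‖(fun _ : ℕ => (1 : ℂ)) n‖ ≤ 1 := fun _ => by simp
  have kfg := hx₀ x hx A hA hA' (cmSign P) (cmSign Q) (cmSign_mul P) (norm_cmSign_le P) (cmSign_mul Q) (norm_cmSign_le Q)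
  have kf1 := hx₀ x hx A hA hA' (cmSign P) (fun _ => 1) (cmSign_mul P) (norm_cmSign_le P) hone_mul hone_norm
  have k1g := hx₀ x hx A hA hA' (fun _ => 1) (cmSign Q) hone_mul hone_norm (cmSign_mul Q) (norm_cmSign_le Q)
  have k11 := hx₀ x hx A hA hA' (fun _ => 1) (fun _ => 1) hone_mul hone_norm hone_mul hone_norm
  -- evaluate the CM functions on rows / columns
  have hfrow : ∀ a ∈ R, cmSign P a = if a ∈ P then -1 else 1 := by
    intro a ha
    have ha0 : a ≠ 0 := by have := (mem_Ioc.mp ha).1; omega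
    exact cmSign_eq_of_private ha0 fun p hp => ⟨(hP p hp).1, (hP p hp).2 a ha⟩
  have hgcol : ∀ b ∈ Cc, cmSign Q b = if b ∈ Q then -1 else 1 := by
    intro b hb
    have hb0 : b ≠ 0 := by have := (mem_Icc.mp hb).1; omega
    exact cmSign_eq_of_private hb0 fun q hq => ⟨(hQ q hq).1, (hQ q hq).2 b hb⟩
  -- the block sum as a complex number
  set Z : ℂ := ∑ a ∈ R.filter (· ∈ P), ∑ b ∈ Cc.filter (· ∈ Q), (ent lam c a b : ℂ) with hZ
  have hcomb : (∑ a ∈ R, ∑ b ∈ Cc, cmSign P a * cmSign Q b * (ent lam c a b : ℂ))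
      - (∑ a ∈ R, ∑ b ∈ Cc, cmSign P a * 1 * (ent lam c a b : ℂ))
      - (∑ a ∈ R, ∑ b ∈ Cc, 1 * cmSign Q b * (ent lam c a b : ℂ))
      + (∑ a ∈ R, ∑ b ∈ Cc, 1 * 1 * (ent lam c a b : ℂ)) = 4 * Z := by
    have step1 : (∑ a ∈ R, ∑ b ∈ Cc, cmSign P a * cmSign Q b * (ent lam c a b : ℂ))
        - (∑ a ∈ R, ∑ b ∈ Cc, cmSign P a * 1 * (ent lam c a b : ℂ))
        - (∑ a ∈ R, ∑ b ∈ Cc, 1 * cmSign Q b * (ent lam c a b : ℂ))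
        + (∑ a ∈ R, ∑ b ∈ Cc, 1 * 1 * (ent lam c a b : ℂ))
        = ∑ a ∈ R, ∑ b ∈ Cc, (cmSign P a - 1) * (cmSign Q b - 1) * (ent lam c a b : ℂ) := by
      rw [← sum_sub_distrib, ← sum_sub_distrib, ← sum_add_distrib]
      refine sum_congr rfl fun a _ => ?_
      rw [← sum_sub_distrib, ← sum_sub_distrib, ← sum_add_distrib]
      refine sum_congr rfl fun b _ => ?_
      ring
    rw [step1]
    have step2 : ∑ a ∈ R, ∑ b ∈ Cc, (cmSign P a - 1) * (cmSign Q b - 1) * (ent lam c a b : ℂ)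
        = ∑ a ∈ R, ∑ b ∈ Cc, (if a ∈ P then (-2 : ℂ) else 0) * ((if b ∈ Q then (-2 : ℂ) else 0) * (ent lam c a b : ℂ)) := by
      refine sum_congr rfl fun a ha => sum_congr rfl fun b hb => ?_
      rw [hfrow a ha, hgcol b hb]
      split_ifs <;> ring
    rw [step2]
    have step3 : ∀ a ∈ R, ∑ b ∈ Cc, (if a ∈ P then (-2 : ℂ) else 0) * ((if b ∈ Q then (-2 : ℂ) else 0) * (ent lam c a b : ℂ))
        = (if a ∈ P then (-2 : ℂ) else 0) * ((-2) * ∑ b ∈ Cc.filter (· ∈ Q), (ent lam c a b : ℂ)) := by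
      intro a _
      conv_rhs =>
        rw [Finset.sum_filter (p := fun b => b ∈ Q) (f := fun b => (ent lam c a b : ℂ)), mul_sum, mul_sum]
      refine sum_congr rfl fun b _ => ?_
      split_ifs <;> ring
    rw [sum_congr rfl step3]
    rw [hZ]
    rw [Finset.sum_filter (p := fun a => a ∈ P)
      (f := fun a => ∑ b ∈ Cc.filter (· ∈ Q), (ent lam c a b : ℂ))]
    rw [mul_sum]
    refine sum_congr rfl fun a _ => ?_
    split_ifs <;> ring
  -- triangle inequality
  have hnorm : ‖(4 : ℂ) * Z‖ ≤ 4 * (x / Real.log x ^ C) := by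
    rw [← hcomb]
    calc _ ≤ ‖(∑ a ∈ R, ∑ b ∈ Cc, cmSign P a * cmSign Q b * (ent lam c a b : ℂ))
            - (∑ a ∈ R, ∑ b ∈ Cc, cmSign P a * 1 * (ent lam c a b : ℂ))
            - (∑ a ∈ R, ∑ b ∈ Cc, 1 * cmSign Q b * (ent lam c a b : ℂ))‖
            + ‖∑ a ∈ R, ∑ b ∈ Cc, 1 * 1 * (ent lam c a b : ℂ)‖ := norm_add_le _ _
      _ ≤ (‖(∑ a ∈ R, ∑ b ∈ Cc, cmSign P a * cmSign Q b * (ent lam c a b : ℂ))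
            - (∑ a ∈ R, ∑ b ∈ Cc, cmSign P a * 1 * (ent lam c a b : ℂ))‖
            + ‖∑ a ∈ R, ∑ b ∈ Cc, 1 * cmSign Q b * (ent lam c a b : ℂ)‖)
            + ‖∑ a ∈ R, ∑ b ∈ Cc, 1 * 1 * (ent lam c a b : ℂ)‖ := by
          gcongr; exact norm_sub_le _ _
      _ ≤ ((‖∑ a ∈ R, ∑ b ∈ Cc, cmSign P a * cmSign Q b * (ent lam c a b : ℂ)‖
            + ‖∑ a ∈ R, ∑ b ∈ Cc, cmSign P a * 1 * (ent lam c a b : ℂ)‖)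
            + ‖∑ a ∈ R, ∑ b ∈ Cc, 1 * cmSign Q b * (ent lam c a b : ℂ)‖)
            + ‖∑ a ∈ R, ∑ b ∈ Cc, 1 * 1 * (ent lam c a b : ℂ)‖ := by
          gcongr; exact norm_sub_le _ _
      _ ≤ ((x / Real.log x ^ C + x / Real.log x ^ C) + x / Real.log x ^ C) + x / Real.log x ^ C := by
          gcongr
      _ = 4 * (x / Real.log x ^ C) := by ring
  have hZle : ‖Z‖ ≤ x / Real.log x ^ C := by
    rw [norm_mul] at hnorm
    have h4 : ‖(4 : ℂ)‖ = 4 := by simp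
    rw [h4] at hnorm
    linarith
  -- back to ℝ
  have hZreal : Z = ((∑ a ∈ R.filter (· ∈ P), ∑ b ∈ Cc.filter (· ∈ Q), ent lam c a b : ℝ) : ℂ) := by
    rw [hZ]; push_cast; rfl
  rw [hZreal, Complex.norm_real, Real.norm_eq_abs] at hZle
  exact hZle

/-- The crux itself implies `PrimeBlockFace` (test vectors `u = ±𝟙_P`, `v = 𝟙_Q` in `BoundedTestVectorFace`; recorded via
the real form: `|Σ_{P×Q}| ≤ 2x/(log x)^C`). Stated for completeness in the weaker constant `2x/(log x)^C`. -/
theorem primeBlock_of_tableChowla (h : LiouvilleShiftedTables.TableChowla) :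
    ∀ c : ℤ, c ≠ 0 → ∀ δ : ℝ, 0 < δ → δ ≤ 1 / 12 → ∀ C : ℝ, 0 < C → ∃ x₀ : ℝ, ∀ x : ℝ, x₀ ≤ x →
    ∀ A : ℝ, x ^ δ ≤ A → A ≤ x ^ (1 / 3 + δ) → ∀ P Q : Finset ℕ,
      |∑ a ∈ (Ioc ⌊A⌋₊ ⌊2 * A⌋₊).filter (· ∈ P), ∑ b ∈ (Icc 1 ⌊x / A⌋₊).filter (· ∈ Q), ent lam c a b| ≤
        2 * x / Real.log x ^ C := by
  intro c hc δ hδ hδ' C hC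
  obtain ⟨x₀, hx₀⟩ := boundedTestVectorFace_of_tableChowla h c hc δ hδ hδ' C hC
  refine ⟨x₀, fun x hx A hA hA' P Q => ?_⟩
  have key := hx₀ x hx A hA hA' (fun a => if a ∈ P then 1 else 0) (fun b => if b ∈ Q then 1 else 0)
    (fun n => by by_cases hn : n ∈ P <;> simp [hn]) (fun n => by by_cases hn : n ∈ Q <;> simp [hn])
  have hrew : ∑ a ∈ (Ioc ⌊A⌋₊ ⌊2 * A⌋₊).filter (· ∈ P), ∑ b ∈ (Icc 1 ⌊x / A⌋₊).filter (· ∈ Q), ent lam c a b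
      = ∑ a ∈ Ioc ⌊A⌋₊ ⌊2 * A⌋₊, ∑ b ∈ Icc 1 ⌊x / A⌋₊,
          (if a ∈ P then (1 : ℝ) else 0) * (if b ∈ Q then (1 : ℝ) else 0) * ent lam c a b := by
    rw [sum_filter]
    refine sum_congr rfl fun a _ => ?_
    rw [sum_filter]
    by_cases ha : a ∈ P
    · simp only [ha, if_true, one_mul]
      refine sum_congr rfl fun b _ => ?_
      split_ifs <;> simp
    · simp only [ha, if_false, zero_mul, sum_const_zero]
  rw [hrew]
  exact key

end

end Summit.Parity.GeneralizedHardyLittlewood.Cruxes.TableChowla.CalibrationIdeator2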